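import Summits.QuantumFields.BalabanUV.T4Continuum.Spine.NE1p.DressedSmallFieldRadiiWitness
import Summits.QuantumFields.BalabanUV.T4Continuum.Spine.NE1p.DressedSmallFieldPencilInjective

/-!
# T⁴ programme, spine estimate NE1′ (node O3b/H2) — WITNESS TAIL «THE LINEAGE's CORES WITNESSES GO COMPLEX»: W100's pencil injectivity
# APPLIED BY NAME to W35 ∕ W41 ∕ W47 — the μ-ENDs' bounded quantities are live at every non-zero COMPLEX source of a sub-disc, and
# W41's TWO-RADII activity is injective on `4ρr < 1`

Cell `pub-balaban`, sub-cell `t4`, row NE1′ formalisation crew (`t4/formal/NE1p/LEAVES.md` row W⟨next⟩ ∕ DAG N29⟨next⟩; INTENT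
`HOME/CLAIMS.log` l.25313), unit `b2b-balaban-t4-ne1p-formalise-leaf-09` (gen 15).  ADDITIVE — imports W47 `Spine/NE1p/DressedSmallFieldRadiiWitness`
(p232398; → W41 `DressedSmallFieldDepCoresWitness{,Live}` p229474 ∕ p229827 → W35 `DressedSmallFieldCoresMassWitness` p227597 → W33, all of
this lineage but W33) and W100 PART 1 `Spine/NE1p/DressedSmallFieldPencilInjective` (p244860) ONLY; own namespace; THEOREMS ONLY (0 def, 0
`def … : Prop`, 0 cite, 0 sorry, 0 `attribute`); W35's `termBi_coreFam_M` ∕ `norm_actM_X₀_lt_one`, W41's `termAt_coreV_pencil` ∕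
`termAt_coreW_pencil` ∕ `norm_actD_X₀_lt_one`, W47's `sum_cT_X₀_pos` ∕ `norm_actT_X₀_lt_one`, W35's `cM_pos`, W24's `exp_locE_cube` and
W100's `pencil` ∕ `pencilM` ∕ `pencil_injOn` ∕ `norm_pencil_sub_sub_lin_le` ∕ `pencilM_pos` are used BY NAME — nothing restated.

WHY.  W100 closed the crew-wide gap «real-source liveness vs complex-disc μ-ENDs» for W33 (PART 1 §3) and W87 (PART 2).  Three more
Gaussian-core witnesses of THIS lineage state their μ-END's liveness for a REAL source only: W35 (`coresMuEnd_live`, N0q's cores-mass μ-END),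
W41 (`depCoresMuEnd_live`, N0r §2's dependent-dom ENDs) and W47 (`muFamiliesEnd_live`, N0t's radii ∕ μ-families END).  Their activities
at `X₀` are, by `rfl` on the already-landed closed forms, `cM r·pencil r s`, `(cM(2r)∕2)·pencil (2r) s + (cM r∕2)·pencil r s` and
`(Σ_𝐃 cT 𝐃)·pencil r s`; the first and third are injective on `2ρr < 1` by W100 at once, the second — TWO contour radii `2r` and `r` — needs
W100's linearisation estimate at BOTH radii and is injective on `4ρr < 1` (the doubled radius of W41's two-label core halves the disc).
* §1 W35: `actM_X₀_eq_pencil`, `actM_injOn`, **`coresMuEnd_live_complex`**, `coresMuEnd_eq_iff`;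
* §2 W41: `actD_X₀_eq_pencil`, **`norm_actD_sub_sub_lin_le`** (the two-radii sandwich), **`actD_injOn (4ρr < 1)`**, **`depCoresMuEnd_live_complex`**,
  `depCoresMuEnd_eq_iff`;
* §3 W47: `actT_X₀_eq_pencil`, `actT_injOn`, **`muFamiliesEnd_live_complex`**, `muFamiliesEnd_eq_iff`;
* closing `example`s: the real pairs `(t, 0)` of W35 ∕ W47 (resp. W41) are recovered from the complex statements ONLY for `2tr < 1` (resp.
  `4tr < 1`) — the real lemmas stay radius-free and are NOT superseded.

HONEST FRAMING.  DECIDED TOYS ([folklore]; 0 sorry; 0 citations; no `def`): W33's Gaussian cores on NE5's toy frame at W35 ∕ W41 ∕ W47's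
weights — the radii `2ρr < 1` ∕ `4ρr < 1` are OURS and only SUFFICIENT; statements about the toy terms ∕ logarithms as functions of the
complex source, NOT about Bałaban's (2.14) densities; NO END newly fired — no binder of N0q ∕ N0r ∕ N0t exercised beyond what W35 ∕ W41 ∕ W47
already fire; the μ-extension READING stays the cell's, UNPRINTED (C-t4r2-340 (n1)); (B1b) NOT claimed; (B3) = W24's located constant BY CHOICE
in the three witnesses (G-ne9p2-5 UNPRINTED); 0 binders instantiated on Bałaban's densities; no wall item; wall v1.8 (T4-DAG v48; v49–v55
verbatim) — words, not kind — does NOT move; R-t4r2-Q2 NOT met; NE1′ ⇐ the named binders — NOT proved, NOT printed; spine PROVED 0∕9; count 9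
unchanged.  Rung (B)+1 on ONE finite four-torus — NOT infinite volume, NOT a mass gap, NOT OS on ℝ⁴, NOT Clay.
HONEST DEPENDENCY: continuum YM on T⁴ ⇐ BetaPertH ∧ nine spine estimates (0/9 proved); BetaPertH ⇐ (D1) ∧ (D4) ∧ CAP+tail; G-an2-4
gates asym, D1 and NE2/3/4.
-/

noncomputable section

namespace Summit.QuantumFields.BalabanUV.T4Continuum.NE1p.DressedSmallFieldCoresComplexSource

open Set Metric MeasureTheory Complex
open scoped BigOperators
open Literature.MathematicalPhysics.QuantumFieldTheory.Balaban1983to89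
open Literature.MathematicalPhysics.QuantumFieldTheory.Balaban1983to89.B13Resummation (locE)
open Literature.MathematicalPhysics.QuantumFieldTheory.Balaban1983to89.TreeLengthTorus (TDom tsys)
open Literature.MathematicalPhysics.QuantumFieldTheory.Balaban1983to89.TreeLengthTorusGeometry (tgeometry TTouch)
open Summit.QuantumFields.BalabanUV.T4Continuum.NE1p.DressedSmallFieldTorusWitness (X₀ exp_locE_cube)
open Summit.QuantumFields.BalabanUV.T4Continuum.NE1p.DressedSmallFieldCoresWitness (E1 crd termsW_X₀)
open Summit.QuantumFields.BalabanUV.T4Continuum.NE1p.DressedSmallFieldCoresMassWitness (cM cM_pos actM termBi_coreFam_M norm_actM_X₀_lt_one)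
open Summit.QuantumFields.BalabanUV.T4Continuum.NE1p.DressedSmallFieldDepCoresWitness (actD termsD_X₀ GD_true GD_false termAt_coreV_pencil
  termAt_coreW_pencil norm_actD_X₀_lt_one)
open Summit.QuantumFields.BalabanUV.T4Continuum.NE1p.DressedSmallFieldRadiiWitness (actT GT termsT cT sum_cT_X₀_pos norm_actT_X₀_lt_one)
open Summit.QuantumFields.BalabanUV.T4Continuum.NE1p.DressedSmallFieldPencilInjective (pencil pencilM pencil_injOn norm_pencil_sub_sub_lin_le
  pencilM_pos pencilM_nonneg)

variable (N : ℕ) [NeZero N] (r : ℝ) (hr : 0 ≤ r)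

/-! ## §1 W35 — the letter-budget cores activity `actM` is `cM r·pencil r s` at the cube; N0q's μ-END quantity is live at complex sources -/

/-- W35's activity at `X₀` READ THROUGH the pencil term: `actM N r hr k s X₀ = cM r·pencil r s` (W35's `termBi_coreFam_M` BY NAME). [folklore] -/
theorem actM_X₀_eq_pencil (k : ℕ) (s : ℂ) : actM N r hr k s (X₀ N) = (cM r : ℂ) * pencil r s := by
  unfold actM
  rw [termsW_X₀, Finset.sum_singleton, termBi_coreFam_M]
  rfl

/-- **W35's activity at `X₀` is injective in the complex source** on `closedBall 0 ρ`, `2ρr < 1` (`cM r ≠ 0`, W100's `pencil_injOn`). [folklore] -/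
theorem actM_injOn (hr0 : 0 < r) (k : ℕ) {ρ : ℝ} (hρ : 0 ≤ ρ) (h2 : 2 * ρ * r < 1) :
    InjOn (fun s : ℂ => actM N r hr k s (X₀ N)) (closedBall (0 : ℂ) ρ) := by
  intro s hs s' hs' heq
  have h : (cM r : ℂ) * pencil r s = (cM r : ℂ) * pencil r s' := by
    have := heq; simp only [actM_X₀_eq_pencil] at this; exact this
  have hc : (cM r : ℂ) ≠ 0 := by exact_mod_cast (cM_pos r).ne'
  exact pencil_injOn r hr0 hρ h2 hs hs' (mul_left_cancel₀ hc h)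

open Classical in
/-- **COMPLEX-SOURCE LIVENESS OF N0q's CORES-MASS μ-END QUANTITY** [decided toy]: for distinct complex sources `s ≠ s′` with `‖s‖, ‖s′‖ ≤ ρ ≤ 2`
and `2ρr < 1`, `E_{H_s}(X₀) ≠ E_{H_{s′}}(X₀)` — W24's `exp_locE_cube` with W35's `norm_actM_X₀_lt_one` (`‖s‖ ≤ 2`) turns equal outputs into equal
activities, §1's `actM_injOn` forbids that.  W35's `coresMuEnd_live` is the real pair `(t, 0)`, radius-free. [folklore] -/
theorem coresMuEnd_live_complex (hr0 : 0 < r) (k : ℕ) {ρ : ℝ} (hρ2 : ρ ≤ 2) (h2 : 2 * ρ * r < 1) {s s' : ℂ} (hs : ‖s‖ ≤ ρ)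
    (hs' : ‖s'‖ ≤ ρ) (hne : s ≠ s') :
    locE (tgeometry 4 N).ι (tgeometry 4 N).cubes (actM N r hr k s) ((tgeometry 4 N).cubes (X₀ N)) ≠
      locE (tgeometry 4 N).ι (tgeometry 4 N).cubes (actM N r hr k s') ((tgeometry 4 N).cubes (X₀ N)) := by
  intro h
  have h1 := exp_locE_cube N (w := actM N r hr k s) (norm_actM_X₀_lt_one N r hr k (hs.trans hρ2))
  have h0 := exp_locE_cube N (w := actM N r hr k s') (norm_actM_X₀_lt_one N r hr k (hs'.trans hρ2))
  have h' : cexp (locE (TTouch (d := 4) (N := N)) (fun Z : (tsys 4 N).Dom => Z.1) (actM N r hr k s) {0}) =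
      cexp (locE (TTouch (d := 4) (N := N)) (fun Z : (tsys 4 N).Dom => Z.1) (actM N r hr k s') {0}) := congrArg cexp h
  rw [h1, h0, add_right_inj] at h'
  exact hne (actM_injOn N r hr hr0 k ((norm_nonneg s).trans hs) h2 (mem_closedBall_zero_iff.2 hs) (mem_closedBall_zero_iff.2 hs') h')

open Classical in
/-- … `↔` form: on the disc, `E_{H_s}(X₀) = E_{H_{s′}}(X₀) ↔ s = s′`. [folklore] -/
theorem coresMuEnd_eq_iff (hr0 : 0 < r) (k : ℕ) {ρ : ℝ} (hρ2 : ρ ≤ 2) (h2 : 2 * ρ * r < 1) {s s' : ℂ} (hs : ‖s‖ ≤ ρ) (hs' : ‖s'‖ ≤ ρ) :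
    locE (tgeometry 4 N).ι (tgeometry 4 N).cubes (actM N r hr k s) ((tgeometry 4 N).cubes (X₀ N)) =
        locE (tgeometry 4 N).ι (tgeometry 4 N).cubes (actM N r hr k s') ((tgeometry 4 N).cubes (X₀ N)) ↔ s = s' :=
  ⟨fun h => by_contra fun hne => coresMuEnd_live_complex N r hr hr0 k hρ2 h2 hs hs' hne h, fun h => by rw [h]⟩

/-! ## §2 W41 — THE TWO-RADII ACTIVITY `actD = (cM(2r)∕2)·pencil (2r) + (cM r∕2)·pencil r` is injective on `4ρr < 1` -/

/-- W41's activity at `X₀` READ THROUGH the pencil terms at the two contour radii `2r` (the two-label core) and `r`: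
`actD r hr N k s X₀ = (cM(2r)∕2)·pencil (2r) s + (cM r∕2)·pencil r s` (W41's `termAt_coreV_pencil` ∕ `termAt_coreW_pencil` BY NAME). [folklore] -/
theorem actD_X₀_eq_pencil (k : ℕ) (s : ℂ) :
    actD r hr N k s (X₀ N) = ((cM (2 * r) / 2 : ℝ) : ℂ) * pencil (2 * r) s + ((cM r / 2 : ℝ) : ℂ) * pencil r s := by
  unfold actD
  rw [termsD_X₀, Fintype.sum_bool]
  simp only [GD_true, GD_false]
  rw [termAt_coreV_pencil, termAt_coreW_pencil]
  rfl

include hr in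
/-- **THE TWO-RADII SANDWICH** [folklore]: for `‖s‖, ‖s′‖ ≤ ρ` and `2ρr ≤ 1`, with `a := cM(2r)∕2`, `b := cM r∕2`,
`‖actD s X₀ − actD s′ X₀ − (s − s′)·(a·pencilM (2r) + b·pencilM r)‖ ≤ 4ρr·(a·pencilM (2r) + b·pencilM r)·‖s − s′‖` — W100's
`norm_pencil_sub_sub_lin_le` at radius `2r` (constant `2ρ(2r) = 4ρr`) and at radius `r` (constant `2ρr ≤ 4ρr`), triangle inequality. -/
theorem norm_actD_sub_sub_lin_le (k : ℕ) {ρ : ℝ} (hρ : 0 ≤ ρ) (hρr : 2 * ρ * r ≤ 1) {s s' : ℂ} (hs : ‖s‖ ≤ ρ) (hs' : ‖s'‖ ≤ ρ) :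
    ‖actD r hr N k s (X₀ N) - actD r hr N k s' (X₀ N) -
        (s - s') * (((cM (2 * r) / 2 * pencilM (2 * r) + cM r / 2 * pencilM r : ℝ) : ℂ))‖ ≤
      4 * ρ * r * (cM (2 * r) / 2 * pencilM (2 * r) + cM r / 2 * pencilM r) * ‖s - s'‖ := by
  have hr2 : 0 ≤ 2 * r := by positivity
  have h2 := norm_pencil_sub_sub_lin_le (2 * r) hr2 hρ (by nlinarith) hs hs'
  have h1 := norm_pencil_sub_sub_lin_le r hr hρ (by nlinarith [mul_nonneg hρ hr]) hs hs'
  have ha : 0 ≤ cM (2 * r) / 2 := (half_pos (cM_pos (2 * r))).le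
  have hb : 0 ≤ cM r / 2 := (half_pos (cM_pos r)).le
  have hM1 : 0 ≤ pencilM r := pencilM_nonneg r hr
  have heq : actD r hr N k s (X₀ N) - actD r hr N k s' (X₀ N) -
        (s - s') * (((cM (2 * r) / 2 * pencilM (2 * r) + cM r / 2 * pencilM r : ℝ) : ℂ)) =
      ((cM (2 * r) / 2 : ℝ) : ℂ) * (pencil (2 * r) s - pencil (2 * r) s' - (s - s') * (pencilM (2 * r) : ℂ)) +
        ((cM r / 2 : ℝ) : ℂ) * (pencil r s - pencil r s' - (s - s') * (pencilM r : ℂ)) := by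
    rw [actD_X₀_eq_pencil, actD_X₀_eq_pencil]; push_cast; ring
  rw [heq]
  have hn2 : ‖((cM (2 * r) / 2 : ℝ) : ℂ) * (pencil (2 * r) s - pencil (2 * r) s' - (s - s') * (pencilM (2 * r) : ℂ))‖ ≤
      cM (2 * r) / 2 * (2 * ρ * (2 * r) * pencilM (2 * r) * ‖s - s'‖) := by
    rw [norm_mul, Complex.norm_real, Real.norm_eq_abs, abs_of_nonneg ha]
    exact mul_le_mul_of_nonneg_left h2 ha
  have hn1 : ‖((cM r / 2 : ℝ) : ℂ) * (pencil r s - pencil r s' - (s - s') * (pencilM r : ℂ))‖ ≤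
      cM r / 2 * (2 * ρ * r * pencilM r * ‖s - s'‖) := by
    rw [norm_mul, Complex.norm_real, Real.norm_eq_abs, abs_of_nonneg hb]
    exact mul_le_mul_of_nonneg_left h1 hb
  have hup : cM r / 2 * (2 * ρ * r * pencilM r * ‖s - s'‖) ≤ cM r / 2 * (4 * ρ * r * pencilM r * ‖s - s'‖) := by
    apply mul_le_mul_of_nonneg_left _ hb
    have h0 : 0 ≤ ρ * r * pencilM r * ‖s - s'‖ := mul_nonneg (mul_nonneg (mul_nonneg hρ hr) hM1) (norm_nonneg _)
    nlinarith
  calc _ ≤ _ := norm_add_le _ _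
    _ ≤ cM (2 * r) / 2 * (2 * ρ * (2 * r) * pencilM (2 * r) * ‖s - s'‖) + cM r / 2 * (4 * ρ * r * pencilM r * ‖s - s'‖) :=
        add_le_add hn2 (hn1.trans hup)
    _ = 4 * ρ * r * (cM (2 * r) / 2 * pencilM (2 * r) + cM r / 2 * pencilM r) * ‖s - s'‖ := by ring

/-- **W41's TWO-RADII ACTIVITY AT `X₀` IS INJECTIVE IN THE COMPLEX SOURCE ON `closedBall 0 ρ`, `4ρr < 1`** (`0 < r`): an equality would put
the full linear term `(s − s′)·(a·pencilM (2r) + b·pencilM r)` — of size `(a·pencilM (2r) + b·pencilM r)·‖s − s′‖` with a POSITIVE bracket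
(W35's `cM_pos`, W100's `pencilM_pos`) — under `4ρr` times itself. [folklore] -/
theorem actD_injOn (hr0 : 0 < r) (k : ℕ) {ρ : ℝ} (hρ : 0 ≤ ρ) (h4 : 4 * ρ * r < 1) :
    InjOn (fun s : ℂ => actD r hr N k s (X₀ N)) (closedBall (0 : ℂ) ρ) := by
  intro s hs s' hs' heq
  have hs0 := mem_closedBall_zero_iff.1 hs
  have hs0' := mem_closedBall_zero_iff.1 hs'
  have h := norm_actD_sub_sub_lin_le N r hr0.le k hρ (by nlinarith [mul_nonneg hρ hr0.le]) hs0 hs0'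
  have heq' : actD r hr N k s (X₀ N) = actD r hr N k s' (X₀ N) := heq
  rw [heq', sub_self, zero_sub, norm_neg, norm_mul, Complex.norm_real, Real.norm_eq_abs] at h
  have hB : 0 < cM (2 * r) / 2 * pencilM (2 * r) + cM r / 2 * pencilM r :=
    add_pos (mul_pos (half_pos (cM_pos _)) (pencilM_pos (2 * r) (by positivity))) (mul_pos (half_pos (cM_pos r)) (pencilM_pos r hr0))
  rw [abs_of_pos hB] at h
  have hn : ‖s - s'‖ ≤ 0 := by
    by_contra hlt
    have hpos : 0 < ‖s - s'‖ := not_le.1 hlt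
    have : (1 - 4 * ρ * r) * ((cM (2 * r) / 2 * pencilM (2 * r) + cM r / 2 * pencilM r) * ‖s - s'‖) ≤ 0 := by nlinarith
    have hc : 0 < (1 - 4 * ρ * r) * ((cM (2 * r) / 2 * pencilM (2 * r) + cM r / 2 * pencilM r) * ‖s - s'‖) :=
      mul_pos (by linarith) (mul_pos hB hpos)
    linarith
  exact sub_eq_zero.1 (norm_le_zero_iff.1 hn)

open Classical in
/-- **COMPLEX-SOURCE LIVENESS OF N0r §2's DEPENDENT-DOM μ-END QUANTITY** [decided toy]: for distinct complex sources `s ≠ s′` with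
`‖s‖, ‖s′‖ ≤ ρ ≤ 2` and `4ρr < 1`, `E_{H_s}(X₀) ≠ E_{H_{s′}}(X₀)` (W24's `exp_locE_cube` + W41's `norm_actD_X₀_lt_one` + §2's `actD_injOn`).  W41's
`depCoresMuEnd_live` is the real pair `(t, 0)`, radius-free. [folklore] -/
theorem depCoresMuEnd_live_complex (hr0 : 0 < r) (k : ℕ) {ρ : ℝ} (hρ2 : ρ ≤ 2) (h4 : 4 * ρ * r < 1) {s s' : ℂ} (hs : ‖s‖ ≤ ρ)
    (hs' : ‖s'‖ ≤ ρ) (hne : s ≠ s') :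
    locE (tgeometry 4 N).ι (tgeometry 4 N).cubes (actD r hr N k s) ((tgeometry 4 N).cubes (X₀ N)) ≠
      locE (tgeometry 4 N).ι (tgeometry 4 N).cubes (actD r hr N k s') ((tgeometry 4 N).cubes (X₀ N)) := by
  intro h
  have h1 := exp_locE_cube N (w := actD r hr N k s) (norm_actD_X₀_lt_one r hr N k (hs.trans hρ2))
  have h0 := exp_locE_cube N (w := actD r hr N k s') (norm_actD_X₀_lt_one r hr N k (hs'.trans hρ2))
  have h' : cexp (locE (TTouch (d := 4) (N := N)) (fun Z : (tsys 4 N).Dom => Z.1) (actD r hr N k s) {0}) =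
      cexp (locE (TTouch (d := 4) (N := N)) (fun Z : (tsys 4 N).Dom => Z.1) (actD r hr N k s') {0}) := congrArg cexp h
  rw [h1, h0, add_right_inj] at h'
  exact hne (actD_injOn N r hr hr0 k ((norm_nonneg s).trans hs) h4 (mem_closedBall_zero_iff.2 hs) (mem_closedBall_zero_iff.2 hs') h')

open Classical in
/-- … `↔` form on the disc `4ρr < 1`. [folklore] -/
theorem depCoresMuEnd_eq_iff (hr0 : 0 < r) (k : ℕ) {ρ : ℝ} (hρ2 : ρ ≤ 2) (h4 : 4 * ρ * r < 1) {s s' : ℂ} (hs : ‖s‖ ≤ ρ)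
    (hs' : ‖s'‖ ≤ ρ) :
    locE (tgeometry 4 N).ι (tgeometry 4 N).cubes (actD r hr N k s) ((tgeometry 4 N).cubes (X₀ N)) =
        locE (tgeometry 4 N).ι (tgeometry 4 N).cubes (actD r hr N k s') ((tgeometry 4 N).cubes (X₀ N)) ↔ s = s' :=
  ⟨fun h => by_contra fun hne => depCoresMuEnd_live_complex N r hr hr0 k hρ2 h4 hs hs' hne h, fun h => by rw [h]⟩

/-! ## §3 W47 — the radii ∕ μ-families activity `actT = (Σ_𝐃 cT 𝐃)·pencil r s` at the cube; N0t's μ-END quantity is live at complex sources -/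

/-- W47's activity at `X₀` READ THROUGH the pencil term: `actT N r hr k s X₀ = (Σ_{𝐃 ∈ termsT X₀} cT 𝐃)·pencil r s` (W41's `termAt_coreW_pencil`
per family, `Finset.sum_mul`). [folklore] -/
theorem actT_X₀_eq_pencil (k : ℕ) (s : ℂ) :
    actT N r hr k s (X₀ N) = (((∑ Df ∈ termsT N (X₀ N), cT N r Df) : ℝ) : ℂ) * pencil r s := by
  unfold actT GT
  simp only [termAt_coreW_pencil]
  rw [Complex.ofReal_sum, Finset.sum_mul]
  rfl

/-- **W47's activity at `X₀` is injective in the complex source** on `closedBall 0 ρ`, `2ρr < 1` (total weight `> 0` by W47's `sum_cT_X₀_pos`,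
W100's `pencil_injOn`). [folklore] -/
theorem actT_injOn (hr0 : 0 < r) (k : ℕ) {ρ : ℝ} (hρ : 0 ≤ ρ) (h2 : 2 * ρ * r < 1) :
    InjOn (fun s : ℂ => actT N r hr k s (X₀ N)) (closedBall (0 : ℂ) ρ) := by
  intro s hs s' hs' heq
  have h : (((∑ Df ∈ termsT N (X₀ N), cT N r Df) : ℝ) : ℂ) * pencil r s =
      (((∑ Df ∈ termsT N (X₀ N), cT N r Df) : ℝ) : ℂ) * pencil r s' := by
    have := heq; simp only [actT_X₀_eq_pencil] at this; exact this
  have hc : (((∑ Df ∈ termsT N (X₀ N), cT N r Df) : ℝ) : ℂ) ≠ 0 := by exact_mod_cast (sum_cT_X₀_pos N r).ne'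
  exact pencil_injOn r hr0 hρ h2 hs hs' (mul_left_cancel₀ hc h)

open Classical in
/-- **COMPLEX-SOURCE LIVENESS OF N0t's μ-FAMILIES END QUANTITY** [decided toy]: for distinct complex sources `s ≠ s′` with `‖s‖, ‖s′‖ ≤ ρ ≤ 2`
and `2ρr < 1`, `E_{H_s}(X₀) ≠ E_{H_{s′}}(X₀)` (W24's `exp_locE_cube` + W47's `norm_actT_X₀_lt_one` + §3's `actT_injOn`).  W47's `muFamiliesEnd_live` is
the real pair `(t, 0)`, radius-free. [folklore] -/
theorem muFamiliesEnd_live_complex (hr0 : 0 < r) (k : ℕ) {ρ : ℝ} (hρ2 : ρ ≤ 2) (h2 : 2 * ρ * r < 1) {s s' : ℂ} (hs : ‖s‖ ≤ ρ)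
    (hs' : ‖s'‖ ≤ ρ) (hne : s ≠ s') :
    locE (tgeometry 4 N).ι (tgeometry 4 N).cubes (actT N r hr k s) ((tgeometry 4 N).cubes (X₀ N)) ≠
      locE (tgeometry 4 N).ι (tgeometry 4 N).cubes (actT N r hr k s') ((tgeometry 4 N).cubes (X₀ N)) := by
  intro h
  have h1 := exp_locE_cube N (w := actT N r hr k s) (norm_actT_X₀_lt_one N r hr k (hs.trans hρ2))
  have h0 := exp_locE_cube N (w := actT N r hr k s') (norm_actT_X₀_lt_one N r hr k (hs'.trans hρ2))
  have h' : cexp (locE (TTouch (d := 4) (N := N)) (fun Z : (tsys 4 N).Dom => Z.1) (actT N r hr k s) {0}) =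
      cexp (locE (TTouch (d := 4) (N := N)) (fun Z : (tsys 4 N).Dom => Z.1) (actT N r hr k s') {0}) := congrArg cexp h
  rw [h1, h0, add_right_inj] at h'
  exact hne (actT_injOn N r hr hr0 k ((norm_nonneg s).trans hs) h2 (mem_closedBall_zero_iff.2 hs) (mem_closedBall_zero_iff.2 hs') h')

open Classical in
/-- … `↔` form on the disc `2ρr < 1`. [folklore] -/
theorem muFamiliesEnd_eq_iff (hr0 : 0 < r) (k : ℕ) {ρ : ℝ} (hρ2 : ρ ≤ 2) (h2 : 2 * ρ * r < 1) {s s' : ℂ} (hs : ‖s‖ ≤ ρ)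
    (hs' : ‖s'‖ ≤ ρ) :
    locE (tgeometry 4 N).ι (tgeometry 4 N).cubes (actT N r hr k s) ((tgeometry 4 N).cubes (X₀ N)) =
        locE (tgeometry 4 N).ι (tgeometry 4 N).cubes (actT N r hr k s') ((tgeometry 4 N).cubes (X₀ N)) ↔ s = s' :=
  ⟨fun h => by_contra fun hne => muFamiliesEnd_live_complex N r hr hr0 k hρ2 h2 hs hs' hne h, fun h => by rw [h]⟩

/-! ## Closing: the three μ-ENDs' quantities separate two decided NON-REAL sources; the real pairs are recovered only on the sub-discs -/

open Classical in
/-- On W35's, W41's and W47's data at contour radius `r = 1∕8` the outputs at the purely imaginary sources `i` and `−i` (norm `1 ≤ ρ = 1`,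
`2ρr = ¼ < 1`, `4ρr = ½ < 1`) DIFFER — all three ENDs' bounded quantities read a genuinely complex source. [folklore] -/
example (k : ℕ) :
    locE (tgeometry 4 N).ι (tgeometry 4 N).cubes (actM N (1 / 8) (by norm_num) k Complex.I) ((tgeometry 4 N).cubes (X₀ N)) ≠
        locE (tgeometry 4 N).ι (tgeometry 4 N).cubes (actM N (1 / 8) (by norm_num) k (-Complex.I)) ((tgeometry 4 N).cubes (X₀ N)) ∧
      locE (tgeometry 4 N).ι (tgeometry 4 N).cubes (actD (1 / 8) (by norm_num) N k Complex.I) ((tgeometry 4 N).cubes (X₀ N)) ≠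
        locE (tgeometry 4 N).ι (tgeometry 4 N).cubes (actD (1 / 8) (by norm_num) N k (-Complex.I)) ((tgeometry 4 N).cubes (X₀ N)) ∧
      locE (tgeometry 4 N).ι (tgeometry 4 N).cubes (actT N (1 / 8) (by norm_num) k Complex.I) ((tgeometry 4 N).cubes (X₀ N)) ≠
        locE (tgeometry 4 N).ι (tgeometry 4 N).cubes (actT N (1 / 8) (by norm_num) k (-Complex.I)) ((tgeometry 4 N).cubes (X₀ N)) := by
  have hI : ‖Complex.I‖ ≤ 1 := by rw [Complex.norm_I]
  have hI' : ‖-Complex.I‖ ≤ 1 := by rw [norm_neg, Complex.norm_I]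
  have hne : Complex.I ≠ -Complex.I := fun h => by
    have := congrArg Complex.im h; norm_num at this
  exact ⟨coresMuEnd_live_complex N (1 / 8) (by norm_num) (by norm_num) k (ρ := 1) (by norm_num) (by norm_num) hI hI' hne,
    depCoresMuEnd_live_complex N (1 / 8) (by norm_num) (by norm_num) k (ρ := 1) (by norm_num) (by norm_num) hI hI' hne,
    muFamiliesEnd_live_complex N (1 / 8) (by norm_num) (by norm_num) k (ρ := 1) (by norm_num) (by norm_num) hI hI' hne⟩

/-- THE RADII ARE THE METHOD's: the real pair `(t, 0) = (1, 0)` of W35 ∕ W47's `coresMuEnd_live` ∕ `muFamiliesEnd_live` lies in a disc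
`2ρr < 1` only for `r < ½`, W41's in `4ρr < 1` only for `r < ¼` — at `r = 1` neither complex statement covers it; the real lemmas are NOT
superseded. [folklore] -/
example : ¬ (2 * (1 : ℝ) * 1 < 1) ∧ ¬ (4 * (1 : ℝ) * 1 < 1) ∧ (2 * (1 : ℝ) * (1 / 4) < 1) ∧ ¬ (4 * (1 : ℝ) * (1 / 4) < 1) := by norm_num

end Summit.QuantumFields.BalabanUV.T4Continuum.NE1p.DressedSmallFieldCoresComplexSource

end
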